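import Literature.MathematicalPhysics.QuantumFieldTheory.Balaban1983to89.B6TorusSiteWalks

/-!
# `Balaban1983to89.B6AgmonExponentMultiLevelTorus` — T. Bałaban, *Propagators and renormalization transformations for
# lattice gauge theories. II*, Commun. Math. Phys. **96** (1984) 223–250 [Balaban1984PropagatorsII], (2.45)–(2.46) p. 231 with
# (2.1)–(2.2) p. 224, read for S. Agmon's positive-weight method [Agmon1982]: ★★★ **THE MULTI-SCALE AGMON EXPONENT — the
# weighted site distance `ρ_S` to a block `S` of `𝔅` (step weight `L^{−max(lev z, lev z′)}`) is `(L^{lev})⁻¹`-Lipschitz across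
# every lattice bond at both ends, oscillates by `≤ d+1` on every block, vanishes on `S`, and DOMINATES PRINT'S BLOCK
# DISTANCE (2.46): `(d_T(y(z), S) − 1)∕(2L) ≤ ρ_S(z)`** (file 2 of 2; seat `pub-ymgap-dag-n06-j`; the «ONE geometric lemma»
# left to a successor by width seat `pub-ymgap-dag-n06-w1`, `B9Thm31SiteAgmonWeightY`)

statement-level skeleton of published theorems with citation tags; proofs where landed; nothing here is a claim about the Yang–Mills mass gap

THE PRINT.  [B6] p. 231: «d(y, y′) = inf_Γ |Γ|, where Γ is a contour joining y and y′, built of admissible bonds … d(x, x′) =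
d(y, y′) if x ∈ B^j(y), x′ ∈ B^{j′}(y′)»; the tree's `B6Geom246MultiLevelTorus.bondT ∕ geomT` (two distinct blocks are joined
iff they contain sites at torus sup-distance `≤ 1`; `d_T` = the graph distance).  [B9] p. 397–398: Thm 3.1's bounds decay like
`e^{−δ₀ d(y,y′)}`.  Agmon's method (as typed by `dag-n06-w1`, files 6–10 of its site-coercivity set) proves such decay for
any site exponent `ρ` with `|ρ(z+e_μ) − ρ z| ≤ (L^{lev z})⁻¹, (L^{lev(z+e_μ)})⁻¹` and `|ρ z − ρ w| ≤ D` on blocks; what was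
missing is a `ρ` of this kind that grows like `d_T`.

THE MATHEMATICS (this file).  `ρ_S :=` the infimum of the weighted lengths (`B6TorusSiteWalks.wtLen`) of lattice walks from
the site into the block `S`.  Lipschitz and vanishing on `S` are the triangle inequality; the block oscillation is the in-block
coordinate staircase (`(d+1)(Lʲ − 1)` steps of weight `L^{−j}`).  DOMINATION: for EVERY lattice walk `γ : z ⇝ z′`,
`d_T(y(z), y(z′)) ≤ 2L·W(γ) + 1` (★★ `distT_blkOf_le_of_walk`), by induction on `γ` with a moving anchor: while the walk
stays in blocks at `d_T ≤ 1` from the anchor nothing is claimed; when it first enters a block `Z` at `d_T ≥ 2` from the anchor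
`A` — so `Z` does not touch `A` — the piece since the anchor has `W ≥ 1∕L` (★ `wtLen_ge_of_not_touchT`: either the piece
meets two levels `≥ 2` apart and the BAND LEMMA of file 1 gives `W ≥ R·M_h∕2 ≥ 1∕L`, or all its levels lie in `{i, i+1}`,
`Lⁱ` divides the sides of `A` and `Z`, and ★ THE ALIGNED-CUBES LEMMA `touchT_of_torusSupNorm_le` — a site of `Z` within
torus sup-distance `Lⁱ − 1` of a site of `A` forces `A`, `Z` to touch (per coordinate, two intervals aligned mod `Lⁱ` at gap
`≤ Lⁱ − 2` overlap or abut) — forces `≥ Lⁱ` steps of weight `≥ L^{−(i+1)}`); re-anchor at `Z` (`d_T(A, Z) ≤ 2 ≤ 2L·W`).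

WHAT IS PROVED (sorry-free; nothing of [B6]∕[B9] asserted beyond what is proved).
* §1 `exists_abut_1d` (the one-dimensional aligned-intervals lemma, with a period shift), `blkOf_eq_of_coords` (the cube of a
  block), `corner_add_side_le_N0`, ★ `touchT_of_torusSupNorm_le` (ALIGNED CUBES).
* §2 `distT_blkOf_le_one_of_adj` (adjacent sites lie in equal or touching blocks), `not_touchT_of_two_le_distT`,
  ★ `wtLen_ge_of_not_touchT` (THE HOP BOUND `W ≥ 1∕L`), `distT_le_of_walk_anchored`, ★★ `distT_blkOf_le_of_walk`
  (`d_T(y(z), y(z′)) ≤ 2L·W(γ) + 1`).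
* §3 the exponent `msRhoT D S z`: `msRhoT_nonneg`, `msRhoT_le_wtLen`, `msRhoT_eq_zero_of_blkOf_eq`, `msRhoT_le_add`,
  ★ `abs_msRhoT_sub_le_stepWt`, ★ `abs_msRhoT_tshift_sub_le ∕ _le'` (both bond caps, the shapes of `dag-n06-w1`'s `hρ1 ∕ hρ2`),
  `exists_walk_of_blkOf_eq` (in-block staircase), ★ `abs_msRhoT_sub_le_of_blkOf_eq` (`≤ d+1`, the shape of `hρD`),
  ★★★ `msRhoT_ge` (DOMINATION `(d_T(y(z),S) − 1)∕(2L) ≤ ρ_S z`).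
CONSTANTS.  Rate loss `1∕(2L)` per unit of `d_T`, additive `1`; uniform in `k`, the volume, the member; hypotheses `1 ≤ M_h`,
`1 ≤ P_μ`, `1 ≤ R`, `1 ≤ ℓ` only (all implied by the V1 index `KIdx`).  NON-VACUITY (A6): `ρ_S` is an explicit function on
every member; at `S = y(z)` it vanishes; the domination is an inequality between two explicit quantities.
HONEST SCOPE.  Combinatorial geometry of [B6]'s block partition of the torus; no operator, no estimate of [B9]; NOT a node
discharge; count-neutral; nothing continuum ∕ OS ∕ mass gap ∕ Clay.  NEW file importing `B6TorusSiteWalks` only; nothing landed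
is modified.  Net new unproved facts: 0.
-/

namespace Literature.MathematicalPhysics.QuantumFieldTheory.Balaban1983to89.B6AgmonExponentMultiLevelTorus

open Literature.MathematicalPhysics.QuantumFieldTheory.Balaban1983to89.B4Reflection242 (boxDom mem_boxDom blk)
open Literature.MathematicalPhysics.QuantumFieldTheory.Balaban1983to89.B4TorusKernel.MultiPeriod (circAbs circAbs_nonneg
  circAbs_le_abs circAbs_add_mul abs_add_mul_centre centre torusSupNorm translate torusSupNorm_le_supNorm
  torusSupNorm_translate torusSupNorm_nonneg translate_apply)
open Literature.MathematicalPhysics.QuantumFieldTheory.Balaban1983to89.B4ContourShift (supNorm abs_le_supNorm supNorm_nonneg)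
open Literature.MathematicalPhysics.QuantumFieldTheory.Balaban1983to89.B6MultiLevelBoxOperator
open Literature.MathematicalPhysics.QuantumFieldTheory.Balaban1983to89.B6Geom246MultiLevelBox
open Literature.MathematicalPhysics.QuantumFieldTheory.Balaban1983to89.B6MultiLevelTorusOperator
open Literature.MathematicalPhysics.QuantumFieldTheory.Balaban1983to89.B6Geom246MultiLevelTorus
open Literature.MathematicalPhysics.QuantumFieldTheory.Balaban1983to89.B6TorusSiteWalks

noncomputable section

variable {d : ℕ}

/-! ## §1 Aligned cubes: a site of `Z` close to `A` in the torus sup-distance forces `A`, `Z` to touch -/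

section Aligned

/-- a multiple of `m ≥ 1` lying in `[0, m − 1]`... more precisely: `m ∣ e`, `0 ≤ e`, `e ≤ m − 2` force `e = 0`. [cite: Balaban1984PropagatorsII, (2.1) p.224 (blocks of side Lʲ on the Lʲ-grid), bookkeeping] -/
theorem eq_zero_of_dvd_of_lt {m e : ℤ} (hm : 1 ≤ m) (hdvd : m ∣ e) (h0 : 0 ≤ e) (h1 : e ≤ m - 2) : e = 0 := by
  obtain ⟨c, hc⟩ := hdvd
  rcases lt_trichotomy c 0 with hc0 | hc0 | hc0
  · nlinarith
  · rw [hc, hc0, mul_zero]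
  · nlinarith

/-- **THE ONE-DIMENSIONAL ALIGNED-INTERVALS LEMMA** (with a period shift `N·t`): two half-open integer intervals
`[α_A, α_A + s_A)`, `[α_Z, α_Z + s_Z)` whose ends are multiples of `m`, a period `N` divisible by `m`, and points `a`, `q` of
them with `|a − q + N t| ≤ m − 1`; then the intervals contain points `x`, `x′` with `|x − x′ + N t| ≤ 1` (the shifted intervals
overlap, or are at a gap that is a multiple of `m` and `≤ m − 2`, hence abut).
[cite: Balaban1984PropagatorsII, (2.1) p.224 (blocks of side Lʲ on the Lʲ-grid), (2.46) p.231 (admissible bonds), dictionary] -/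
theorem exists_abut_1d {m N αA sA αZ sZ a q t : ℤ} (hm : 1 ≤ m) (hN : m ∣ N) (hαA : m ∣ αA) (hsA : m ∣ sA)
    (hαZ : m ∣ αZ) (hsZ : m ∣ sZ) (hsA1 : 1 ≤ sA) (hsZ1 : 1 ≤ sZ)
    (ha : αA ≤ a ∧ a < αA + sA) (hq : αZ ≤ q ∧ q < αZ + sZ) (hd : |a - q + N * t| ≤ m - 1) :
    ∃ x x' : ℤ, (αA ≤ x ∧ x < αA + sA) ∧ (αZ ≤ x' ∧ x' < αZ + sZ) ∧ |x - x' + N * t| ≤ 1 := by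
  -- shift the second interval by the period
  set αZ' : ℤ := αZ - N * t with hαZ'
  have hαZ'd : m ∣ αZ' := by rw [hαZ']; exact dvd_sub hαZ (dvd_mul_of_dvd_left hN t)
  have hd' : |a - (q - N * t)| ≤ m - 1 := by rw [show a - (q - N * t) = a - q + N * t by ring]; exact hd
  rw [abs_le] at hd'
  by_cases hov : αA < αZ' + sZ ∧ αZ' < αA + sA
  · -- the shifted intervals overlap
    refine ⟨max αA αZ', max αA αZ' + N * t, ⟨le_max_left _ _, max_lt (by omega) hov.2⟩, ⟨?_, ?_⟩, ?_⟩
    · have := le_max_right αA αZ'; rw [hαZ'] at this; linarith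
    · have h1 : αA < αZ' + sZ := hov.1
      have : max αA αZ' < αZ' + sZ := max_lt h1 (by omega)
      rw [hαZ'] at this; linarith
    · rw [show max αA αZ' - (max αA αZ' + N * t) + N * t = 0 by ring, abs_zero]; exact zero_le_one
  · rcases (by omega : αA + sA ≤ αZ' ∨ αZ' + sZ ≤ αA) with hright | hleft
    · -- `Z` to the right of `A`: the gap is a multiple of `m` and `≤ m − 2`, hence `0`
      have hgap : αZ' - (αA + sA) = 0 := by
        refine eq_zero_of_dvd_of_lt hm (dvd_sub hαZ'd (dvd_add hαA hsA)) (by omega) ?_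
        have : αZ' ≤ q - N * t := by rw [hαZ']; linarith [hq.1]
        omega
      refine ⟨αA + sA - 1, αZ' + N * t, ⟨by omega, by omega⟩, ⟨?_, ?_⟩, ?_⟩
      · rw [hαZ']; linarith
      · rw [hαZ']; linarith
      · rw [show αA + sA - 1 - (αZ' + N * t) + N * t = -(αZ' - (αA + sA)) - 1 by ring, hgap]; norm_num
    · -- `Z` to the left of `A`
      have hgap : αA - (αZ' + sZ) = 0 := by
        refine eq_zero_of_dvd_of_lt hm (dvd_sub hαA (dvd_add hαZ'd hsZ)) (by omega) ?_
        have : q - N * t < αZ' + sZ := by rw [hαZ']; linarith [hq.2]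
        omega
      refine ⟨αA, αZ' + sZ - 1 + N * t, ⟨le_rfl, by omega⟩, ⟨?_, ?_⟩, ?_⟩
      · rw [hαZ']; linarith
      · rw [hαZ']; linarith
      · rw [show αA - (αZ' + sZ - 1 + N * t) + N * t = αA - (αZ' + sZ) + 1 by ring, hgap]; norm_num

variable {ℓ Mh k R : ℕ} {P : Fin (d + 1) → ℕ} (D : TDomains d ℓ Mh k P R)

/-- **THE CUBE OF A BLOCK**: a box site whose coordinates lie in `[Lʲ y_μ, Lʲ y_μ + Lʲ)` for every `μ` belongs to the block
`(j, y)`. [cite: Balaban1984PropagatorsII, (2.1) p.224, (2.45) p.231, dictionary] -/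
theorem blkOf_eq_of_coords {s : ↥(bset D.toDomains)} {x : ↥(boxDom (N0 ℓ Mh k P))}
    (h : ∀ μ, (((ℓ + 1) ^ s.1.1 : ℕ) : ℤ) * s.1.2 μ ≤ x.1 μ ∧ x.1 μ < (((ℓ + 1) ^ s.1.1 : ℕ) : ℤ) * s.1.2 μ + (((ℓ + 1) ^ s.1.1 : ℕ) : ℤ)) :
    blkOf D.toDomains x = s := by
  rw [blkOf_eq_iff_blk]
  funext μ
  have hn : (0 : ℤ) < (((ℓ + 1) ^ s.1.1 : ℕ) : ℤ) := by positivity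
  obtain ⟨h1, h2⟩ := h μ
  show x.1 μ / (((ℓ + 1) ^ s.1.1 : ℕ) : ℤ) = s.1.2 μ
  have hle : s.1.2 μ ≤ x.1 μ / (((ℓ + 1) ^ s.1.1 : ℕ) : ℤ) := by
    rw [Int.le_ediv_iff_mul_le hn]; linarith
  have hlt : x.1 μ / (((ℓ + 1) ^ s.1.1 : ℕ) : ℤ) < s.1.2 μ + 1 := by
    rw [Int.ediv_lt_iff_lt_mul hn]; linarith
  omega

/-- `Lʲ ∣ N₀_μ` for a block level `j ≤ k`. [cite: Balaban1984PropagatorsII, (2.1) p.224 («Lʲ-blocks do not cross the identification»), dictionary] -/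
theorem pow_dvd_N0 {j : ℕ} (hj : j ≤ k) (μ : Fin (d + 1)) : (ℓ + 1) ^ j ∣ N0 ℓ Mh k P μ := by
  obtain ⟨t, ht⟩ := Nat.exists_eq_add_of_le hj
  refine ⟨(ℓ + 1) ^ t * ((ℓ + 1) * (Mh * P μ)), ?_⟩
  simp only [N0, ht, pow_add]; ring

/-- the cube of a block lies in the box: `corner_μ + Lʲ ≤ N₀_μ`. [cite: Balaban1984PropagatorsII, (2.1) p.224, dictionary] -/
theorem corner_add_side_le_N0 (s : ↥(bset D.toDomains)) (μ : Fin (d + 1)) :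
    (((ℓ + 1) ^ s.1.1 : ℕ) : ℤ) * s.1.2 μ + (((ℓ + 1) ^ s.1.1 : ℕ) : ℤ) ≤ (N0 ℓ Mh k P μ : ℤ) := by
  have hc := (mem_boxDom.1 (corner_mem D.toDomains s) μ).2
  simp only [corner] at hc
  obtain ⟨n, hn⟩ := pow_dvd_N0 (ℓ := ℓ) (Mh := Mh) (P := P) (scale_bounds D.toDomains s).2 μ
  have hn' : (N0 ℓ Mh k P μ : ℤ) = (((ℓ + 1) ^ s.1.1 : ℕ) : ℤ) * (n : ℤ) := by exact_mod_cast hn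
  rw [hn'] at hc ⊢
  have hpos : (0 : ℤ) < (((ℓ + 1) ^ s.1.1 : ℕ) : ℤ) := by positivity
  have : s.1.2 μ < (n : ℤ) := lt_of_mul_lt_mul_left hc hpos.le
  nlinarith

/-- ★ **ALIGNED CUBES**: if `m ≥ 1` divides the sides `L^{j_A}`, `L^{j_Z}` of two blocks and the periods `N₀_μ`, and a site of
`Z` is within torus sup-distance `m − 1` of a site of `A`, then `A` and `Z` TOUCH (contain sites at torus distance `≤ 1`).
[cite: Balaban1984PropagatorsII, (2.46) p.231 (admissible bonds), (2.1) p.224, dictionary] -/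
theorem touchT_of_torusSupNorm_le {A Z : ↥(bset D.toDomains)} {m : ℕ} (hm : 1 ≤ m)
    (hmA : m ∣ (ℓ + 1) ^ A.1.1) (hmZ : m ∣ (ℓ + 1) ^ Z.1.1) (hmN : ∀ μ, m ∣ N0 ℓ Mh k P μ)
    {a q : ↥(boxDom (N0 ℓ Mh k P))} (ha : blkOf D.toDomains a = A) (hq : blkOf D.toDomains q = Z)
    (hd : torusSupNorm (N0 ℓ Mh k P) (a.1 - q.1) ≤ (m : ℝ) - 1) : TouchT D A Z := by
  -- per coordinate: the torus coordinate distance is `≤ m − 1`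
  have hcoord : ∀ μ, ∃ x x' : ℤ,
      ((((ℓ + 1) ^ A.1.1 : ℕ) : ℤ) * A.1.2 μ ≤ x ∧ x < (((ℓ + 1) ^ A.1.1 : ℕ) : ℤ) * A.1.2 μ + (((ℓ + 1) ^ A.1.1 : ℕ) : ℤ)) ∧
      ((((ℓ + 1) ^ Z.1.1 : ℕ) : ℤ) * Z.1.2 μ ≤ x' ∧ x' < (((ℓ + 1) ^ Z.1.1 : ℕ) : ℤ) * Z.1.2 μ + (((ℓ + 1) ^ Z.1.1 : ℕ) : ℤ)) ∧
      circAbs (N0 ℓ Mh k P μ) (x - x') ≤ 1 := by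
    intro μ
    have h1 : ((circAbs (N0 ℓ Mh k P μ) ((a.1 - q.1) μ) : ℤ) : ℝ) ≤ (m : ℝ) - 1 :=
      (circAbs_le_torusSupNorm (a.1 - q.1) μ).trans hd
    have h1' : circAbs (N0 ℓ Mh k P μ) (a.1 μ - q.1 μ) ≤ (m : ℤ) - 1 := by
      rw [Pi.sub_apply] at h1; exact_mod_cast h1
    have hone := one_le_N0 (ℓ := ℓ) (k := k) (Mh := Mh) (P := P)
    rw [← abs_add_mul_centre (one_le_of_mem a.2 μ) (a.1 μ - q.1 μ)] at h1'
    obtain ⟨x, x', hx, hx', hxx'⟩ := exists_abut_1d (N := (N0 ℓ Mh k P μ : ℤ)) (t := centre (N0 ℓ Mh k P μ) (a.1 μ - q.1 μ))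
      (by exact_mod_cast hm : (1 : ℤ) ≤ m) (by exact_mod_cast hmN μ) (dvd_mul_of_dvd_left (by exact_mod_cast hmA) _)
      (by exact_mod_cast hmA) (dvd_mul_of_dvd_left (by exact_mod_cast hmZ) _) (by exact_mod_cast hmZ)
      (by exact_mod_cast Nat.one_le_pow _ _ (by omega)) (by exact_mod_cast Nat.one_le_pow _ _ (by omega))
      (coord_bounds D.toDomains ha μ) (coord_bounds D.toDomains hq μ) h1'
    refine ⟨x, x', hx, hx', ?_⟩
    rw [← circAbs_add_mul (N0 ℓ Mh k P μ) (x - x') (centre (N0 ℓ Mh k P μ) (a.1 μ - q.1 μ))]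
    exact (circAbs_le_abs (one_le_of_mem a.2 μ) _).trans hxx'
  choose X X' hX hX' hXX' using hcoord
  -- the two sites lie in the box
  have hcA0 := fun μ => (mem_boxDom.1 (corner_mem D.toDomains A) μ).1
  have hcZ0 := fun μ => (mem_boxDom.1 (corner_mem D.toDomains Z) μ).1
  simp only [corner] at hcA0 hcZ0
  have hXmem : X ∈ boxDom (N0 ℓ Mh k P) := mem_boxDom.2 fun μ =>
    ⟨(hcA0 μ).trans (hX μ).1, lt_of_lt_of_le (hX μ).2 (corner_add_side_le_N0 D A μ)⟩
  have hX'mem : X' ∈ boxDom (N0 ℓ Mh k P) := mem_boxDom.2 fun μ =>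
    ⟨(hcZ0 μ).trans (hX' μ).1, lt_of_lt_of_le (hX' μ).2 (corner_add_side_le_N0 D Z μ)⟩
  refine ⟨⟨X, hXmem⟩, ⟨X', hX'mem⟩, blkOf_eq_of_coords D hX, blkOf_eq_of_coords D hX', ?_⟩
  refine Finset.sup'_le _ _ fun μ _ => ?_
  exact_mod_cast hXX' μ

end Aligned

/-! ## §2 The hop bound and the domination of `d_T` by the weighted length -/

section Domination

variable {ℓ Mh k R : ℕ} {P : Fin (d + 1) → ℕ} (D : TDomains d ℓ Mh k P R)

/-- powers of `L` are monotone (real cast). [cite: Balaban1984PropagatorsII, (2.1) p.224, bookkeeping] -/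
private theorem powL_mono {a b : ℕ} (h : a ≤ b) : (((ℓ + 1) ^ a : ℕ) : ℝ) ≤ (((ℓ + 1) ^ b : ℕ) : ℝ) := by
  exact_mod_cast Nat.pow_le_pow_right (by omega) h

/-- **ADJACENT SITES LIE IN EQUAL OR TOUCHING BLOCKS**: `d_T(y(z), y(z′)) ≤ 1` along a lattice bond.
[cite: Balaban1984PropagatorsII, (2.46) p.231 («d(x, x′) = d(y, y′)»), dictionary] -/
theorem distT_blkOf_le_one_of_adj (hMh : 1 ≤ Mh) (hP : ∀ μ, 1 ≤ P μ) {z z' : ↥(boxDom (N0 ℓ Mh k P))}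
    (h : (latGraphT (N0 ℓ Mh k P)).Adj z z') : (bondT D).dist (blkOf D.toDomains z) (blkOf D.toDomains z') ≤ 1 := by
  have ht : TouchT D (blkOf D.toDomains z) (blkOf D.toDomains z') :=
    ⟨z, z', rfl, rfl, torusSupNorm_le_one_of_adj (one_le_N0 hMh hP) h⟩
  by_cases he : blkOf D.toDomains z = blkOf D.toDomains z'
  · rw [he, SimpleGraph.dist_self]; exact zero_le_one
  · rw [(SimpleGraph.dist_eq_one_iff_adj).2 (bondT_adj.2 ⟨he, ht⟩)]

/-- blocks at `d_T ≥ 2` do not touch. [cite: Balaban1984PropagatorsII, (2.46) p.231, dictionary] -/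
theorem not_touchT_of_two_le_distT {A Z : ↥(bset D.toDomains)} (h : 2 ≤ (bondT D).dist A Z) : ¬ TouchT D A Z := by
  intro ht
  by_cases he : A = Z
  · rw [he, SimpleGraph.dist_self] at h; omega
  · rw [(SimpleGraph.dist_eq_one_iff_adj).2 (bondT_adj.2 ⟨he, ht⟩)] at h; omega

/-- ★ **THE HOP BOUND**: a lattice walk from a site of a block `A` to a site of a block `Z` NOT touching `A` has weighted length
`≥ 1∕L`.  Either it meets two levels `≥ 2` apart (band lemma: `≥ R·M_h∕2`), or all its levels lie in `{i, i+1}`; then `Lⁱ`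
divides both block sides, the aligned-cubes lemma forces the ends to be `≥ Lⁱ` apart on the torus, so the walk has `≥ Lⁱ` steps
of weight `≥ L^{−(i+1)}` each. [cite: Balaban1984PropagatorsII, (2.46) p.231, (2.1)–(2.2) p.224; Agmon1982, Ch.1, dictionary] -/
theorem wtLen_ge_of_not_touchT (hR : 1 ≤ R) (hMh : 1 ≤ Mh) (hP : ∀ μ, 1 ≤ P μ) (hℓ : 1 ≤ ℓ)
    {a q : ↥(boxDom (N0 ℓ Mh k P))} (p : (latGraphT (N0 ℓ Mh k P)).Walk a q)
    (hnt : ¬ TouchT D (blkOf D.toDomains a) (blkOf D.toDomains q)) :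
    (((ℓ + 1 : ℕ) : ℝ))⁻¹ ≤ wtLen D p := by
  classical
  have hN := one_le_N0 (ℓ := ℓ) (k := k) hMh hP
  have hL2 : (2 : ℝ) ≤ ((ℓ + 1 : ℕ) : ℝ) := by exact_mod_cast (by omega : 2 ≤ ℓ + 1)
  have hLpos : (0 : ℝ) < ((ℓ + 1 : ℕ) : ℝ) := by positivity
  by_cases hsp : ∃ lo ∈ p.support, ∃ hi ∈ p.support, D.lev lo.1 + 2 ≤ D.lev hi.1
  · -- two levels `≥ 2` apart: the band lemma
    obtain ⟨lo, hlo, hi, hhi, hle⟩ := hsp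
    have hband := wtLen_ge_of_spread D hR hMh hP (i := D.lev lo.1 + 1) p hlo hhi (Nat.lt_succ_self _) (by omega)
    have hRM : (1 : ℝ) ≤ ((R * Mh : ℕ) : ℝ) := by
      exact_mod_cast Nat.one_le_iff_ne_zero.2 (Nat.mul_ne_zero_iff.2 ⟨by omega, by omega⟩)
    calc (((ℓ + 1 : ℕ) : ℝ))⁻¹ ≤ (2 : ℝ)⁻¹ := inv_anti₀ (by norm_num) hL2
      _ = 1 / 2 := by norm_num
      _ ≤ ((R * Mh : ℕ) : ℝ) / 2 := by linarith
      _ ≤ wtLen D p := hband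
  · -- all levels on the walk lie in `{i, i+1}`, `i` the least level met
    push Not at hsp
    set S : Finset ↥(boxDom (N0 ℓ Mh k P)) := p.support.toFinset with hS
    have hSne : S.Nonempty := ⟨a, by rw [hS, List.mem_toFinset]; exact p.start_mem_support⟩
    set i : ℕ := S.inf' hSne (fun v => D.lev v.1) with hi
    obtain ⟨v₀, hv₀S, hv₀⟩ := Finset.exists_mem_eq_inf' hSne (fun v => D.lev v.1)
    have hv₀' : v₀ ∈ p.support := by rw [hS, List.mem_toFinset] at hv₀S; exact hv₀S
    have hge : ∀ v ∈ p.support, i ≤ D.lev v.1 := fun v hv =>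
      Finset.inf'_le _ (by rw [hS, List.mem_toFinset]; exact hv)
    have hle : ∀ v ∈ p.support, D.lev v.1 ≤ i + 1 := fun v hv => by
      have := hsp v₀ hv₀' v hv; rw [hi, ← hv₀] at *; omega
    have hia : i ≤ D.lev a.1 := hge a p.start_mem_support
    have hiq : i ≤ D.lev q.1 := hge q p.end_mem_support
    have hik : i ≤ k := hia.trans (D.lev_le a.1)
    -- the ends are `≥ Lⁱ` apart on the torus, else `A`, `Z` would touch
    have hfar : (((ℓ + 1) ^ i : ℕ) : ℝ) ≤ torusSupNorm (N0 ℓ Mh k P) (a.1 - q.1) := by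
      by_contra hcon
      push Not at hcon
      obtain ⟨n, hn⟩ := exists_int_torusSupNorm (N := N0 ℓ Mh k P) (a.1 - q.1)
      have hn' : n < (((ℓ + 1) ^ i : ℕ) : ℤ) := by
        have : (n : ℝ) < (((ℓ + 1) ^ i : ℕ) : ℝ) := by rw [← hn]; exact hcon
        exact_mod_cast this
      have hle1 : torusSupNorm (N0 ℓ Mh k P) (a.1 - q.1) ≤ (((ℓ + 1) ^ i : ℕ) : ℝ) - 1 := by
        rw [hn]
        have : n ≤ (((ℓ + 1) ^ i : ℕ) : ℤ) - 1 := by omega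
        exact_mod_cast this
      refine hnt (touchT_of_torusSupNorm_le D (m := (ℓ + 1) ^ i) (Nat.one_le_pow _ _ (by omega))
        (Nat.pow_dvd_pow _ hia) (Nat.pow_dvd_pow _ hiq) (fun μ => pow_dvd_N0 hik μ) rfl rfl ?_)
      exact_mod_cast hle1
    -- `Lⁱ ≤ |a − q|_T ≤ |p| ≤ L^{i+1} · W`
    have h1 := torusSupNorm_le_length hN p
    have h2 := length_le_mul_wtLen D p (J := i + 1) hle
    have hchain : (((ℓ + 1) ^ i : ℕ) : ℝ) ≤ (((ℓ + 1) ^ (i + 1) : ℕ) : ℝ) * wtLen D p := hfar.trans (h1.trans h2)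
    have hpow : (((ℓ + 1) ^ (i + 1) : ℕ) : ℝ) = (((ℓ + 1) ^ i : ℕ) : ℝ) * ((ℓ + 1 : ℕ) : ℝ) := by push_cast; ring
    rw [hpow, mul_assoc] at hchain
    have hpos : (0 : ℝ) < (((ℓ + 1) ^ i : ℕ) : ℝ) := by positivity
    have h3 : 1 ≤ ((ℓ + 1 : ℕ) : ℝ) * wtLen D p := by
      by_contra hcon; push Not at hcon; nlinarith
    have h4 : (((ℓ + 1 : ℕ) : ℝ))⁻¹ * 1 ≤ (((ℓ + 1 : ℕ) : ℝ))⁻¹ * (((ℓ + 1 : ℕ) : ℝ) * wtLen D p) :=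
      mul_le_mul_of_nonneg_left h3 (inv_nonneg.2 hLpos.le)
    rwa [mul_one, ← mul_assoc, inv_mul_cancel₀ hLpos.ne', one_mul] at h4

/-- **DOMINATION WITH A MOVING ANCHOR** (the induction behind `distT_blkOf_le_of_walk`): for a walk `p : w ⇝ y`, an anchor
site `a₀` whose block is at `d_T ≤ 1` from `y(w)`, and the history `r : a₀ ⇝ w`,
`d_T(y(a₀), y(y)) ≤ 2L·(W(r) + W(p)) + 1`. [cite: Balaban1984PropagatorsII, (2.46) p.231; Agmon1982, Ch.1, dictionary] -/
theorem distT_le_of_walk_anchored (hR : 1 ≤ R) (hMh : 1 ≤ Mh) (hP : ∀ μ, 1 ≤ P μ) (hℓ : 1 ≤ ℓ)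
    {w y : ↥(boxDom (N0 ℓ Mh k P))} (p : (latGraphT (N0 ℓ Mh k P)).Walk w y) :
    ∀ (a₀ : ↥(boxDom (N0 ℓ Mh k P))) (r : (latGraphT (N0 ℓ Mh k P)).Walk a₀ w),
      (bondT D).dist (blkOf D.toDomains a₀) (blkOf D.toDomains w) ≤ 1 →
        ((bondT D).dist (blkOf D.toDomains a₀) (blkOf D.toDomains y) : ℝ)
          ≤ 2 * ((ℓ + 1 : ℕ) : ℝ) * (wtLen D r + wtLen D p) + 1 := by
  have hconn := connectedT (D := D) hMh hP
  have hLpos : (0 : ℝ) < ((ℓ + 1 : ℕ) : ℝ) := by positivity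
  induction p with
  | @nil w =>
      intro a₀ r hnear
      have h0 := wtLen_nonneg D r
      have : ((bondT D).dist (blkOf D.toDomains a₀) (blkOf D.toDomains w) : ℝ) ≤ 1 := by exact_mod_cast hnear
      rw [wtLen_nil, add_zero]
      nlinarith
  | @cons w w₁ y hadj p ih =>
      intro a₀ r hnear
      rw [wtLen_cons]
      by_cases h1 : (bondT D).dist (blkOf D.toDomains a₀) (blkOf D.toDomains w₁) ≤ 1
      · -- still near the anchor: extend the history by the step
        have := ih a₀ (r.append (SimpleGraph.Walk.cons hadj SimpleGraph.Walk.nil)) h1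
        rw [wtLen_append, wtLen_cons, wtLen_nil, add_zero] at this
        linarith
      · -- the walk leaves the anchor's neighbourhood: the hop since `a₀` has `W ≥ 1∕L`; re-anchor at `w₁`
        push Not at h1
        have hstep := distT_blkOf_le_one_of_adj D hMh hP hadj
        have hd2 : (bondT D).dist (blkOf D.toDomains a₀) (blkOf D.toDomains w₁) ≤ 2 :=
          (hconn.dist_triangle).trans (by omega : (bondT D).dist (blkOf D.toDomains a₀) (blkOf D.toDomains w)
            + (bondT D).dist (blkOf D.toDomains w) (blkOf D.toDomains w₁) ≤ 2)
        have hnt := not_touchT_of_two_le_distT D (by omega : 2 ≤ (bondT D).dist (blkOf D.toDomains a₀) (blkOf D.toDomains w₁))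
        have hhop := wtLen_ge_of_not_touchT D hR hMh hP hℓ (r.append (SimpleGraph.Walk.cons hadj SimpleGraph.Walk.nil)) hnt
        rw [wtLen_append, wtLen_cons, wtLen_nil, add_zero] at hhop
        have hrest := ih w₁ SimpleGraph.Walk.nil (by rw [SimpleGraph.dist_self]; exact zero_le_one)
        rw [wtLen_nil, zero_add] at hrest
        have htri : (bondT D).dist (blkOf D.toDomains a₀) (blkOf D.toDomains y)
            ≤ (bondT D).dist (blkOf D.toDomains a₀) (blkOf D.toDomains w₁) + (bondT D).dist (blkOf D.toDomains w₁) (blkOf D.toDomains y) :=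
          hconn.dist_triangle
        have htri' : ((bondT D).dist (blkOf D.toDomains a₀) (blkOf D.toDomains y) : ℝ)
            ≤ 2 + ((bondT D).dist (blkOf D.toDomains w₁) (blkOf D.toDomains y) : ℝ) := by
          have : ((bondT D).dist (blkOf D.toDomains a₀) (blkOf D.toDomains y) : ℝ)
              ≤ ((bondT D).dist (blkOf D.toDomains a₀) (blkOf D.toDomains w₁) : ℝ)
                + ((bondT D).dist (blkOf D.toDomains w₁) (blkOf D.toDomains y) : ℝ) := by exact_mod_cast htri
          have h2' : ((bondT D).dist (blkOf D.toDomains a₀) (blkOf D.toDomains w₁) : ℝ) ≤ 2 := by exact_mod_cast hd2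
          linarith
        -- `2 ≤ 2L · (W(r) + w)` from the hop bound
        have hkey : (2 : ℝ) ≤ 2 * ((ℓ + 1 : ℕ) : ℝ) * (wtLen D r + stepWt D w w₁) := by
          have := mul_le_mul_of_nonneg_left hhop hLpos.le
          rw [mul_inv_cancel₀ hLpos.ne'] at this
          nlinarith
        nlinarith [wtLen_nonneg D p, wtLen_nonneg D r, (stepWt_pos D w w₁).le]

/-- ★★ **PRINT'S BLOCK DISTANCE IS DOMINATED BY THE WEIGHTED LENGTH OF ANY LATTICE WALK**:
`d_T(y(z), y(z′)) ≤ 2L·W(γ) + 1` for every lattice walk `γ : z ⇝ z′`.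
[cite: Balaban1984PropagatorsII, (2.46) p.231 («d(x, x′) = d(y, y′)»), (2.1)–(2.2) p.224; Balaban1985BackgroundPropagators, p.397 (weighted distance); Agmon1982, Ch.1] -/
theorem distT_blkOf_le_of_walk (hR : 1 ≤ R) (hMh : 1 ≤ Mh) (hP : ∀ μ, 1 ≤ P μ) (hℓ : 1 ≤ ℓ)
    {z z' : ↥(boxDom (N0 ℓ Mh k P))} (p : (latGraphT (N0 ℓ Mh k P)).Walk z z') :
    ((bondT D).dist (blkOf D.toDomains z) (blkOf D.toDomains z') : ℝ) ≤ 2 * ((ℓ + 1 : ℕ) : ℝ) * wtLen D p + 1 := by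
  have := distT_le_of_walk_anchored D hR hMh hP hℓ p z SimpleGraph.Walk.nil (by rw [SimpleGraph.dist_self]; exact zero_le_one)
  rwa [wtLen_nil, zero_add] at this

end Domination

/-! ## §3 The multi-scale Agmon exponent `ρ_S` and its four properties -/

section Exponent

variable {ℓ Mh k R : ℕ} {P : Fin (d + 1) → ℕ} (D : TDomains d ℓ Mh k P R)

/-- ★★★ **THE MULTI-SCALE AGMON EXPONENT** `ρ_S(z)`: the least weighted length (`B6TorusSiteWalks.wtLen`, step weight
`L^{−max(lev, lev′)}`) of a lattice walk from the site `z` into the block `S ∈ 𝔅` — the site-level refinement of print's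
weighted distance `d(y, y′)` adapted to `{Ω_j}`. [cite: Balaban1985BackgroundPropagators, p.397 («the weighted distance d(y,y′) defined by (2.36) in [4]»); Balaban1984PropagatorsII, (2.46) p.231; Agmon1982, Ch.1] -/
def msRhoT (S : ↥(bset D.toDomains)) (z : ↥(boxDom (N0 ℓ Mh k P))) : ℝ :=
  sInf {r : ℝ | ∃ (x : ↥(boxDom (N0 ℓ Mh k P))) (p : (latGraphT (N0 ℓ Mh k P)).Walk z x), blkOf D.toDomains x = S ∧ wtLen D p = r}

/-- the defining set is inhabited (the lattice graph is connected and every block has a site). [cite: Balaban1984PropagatorsII, (2.45) p.231, bookkeeping] -/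
theorem msRhoT_set_nonempty (hMh : 1 ≤ Mh) (hP : ∀ μ, 1 ≤ P μ) (S : ↥(bset D.toDomains)) (z : ↥(boxDom (N0 ℓ Mh k P))) :
    {r : ℝ | ∃ (x : ↥(boxDom (N0 ℓ Mh k P))) (p : (latGraphT (N0 ℓ Mh k P)).Walk z x), blkOf D.toDomains x = S ∧ wtLen D p = r}.Nonempty := by
  obtain ⟨x, hx⟩ := exists_blkOf_eq D.toDomains S
  obtain ⟨p⟩ := latGraphT_reachable (one_le_N0 hMh hP) z x
  exact ⟨_, x, p, hx, rfl⟩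

/-- the defining set is bounded below by `0`. [cite: Balaban1984PropagatorsII, (2.45) p.231, bookkeeping] -/
theorem msRhoT_set_bddBelow (S : ↥(bset D.toDomains)) (z : ↥(boxDom (N0 ℓ Mh k P))) :
    BddBelow {r : ℝ | ∃ (x : ↥(boxDom (N0 ℓ Mh k P))) (p : (latGraphT (N0 ℓ Mh k P)).Walk z x), blkOf D.toDomains x = S ∧ wtLen D p = r} := by
  refine ⟨0, ?_⟩
  rintro _ ⟨x, p, _, rfl⟩
  exact wtLen_nonneg D p

/-- `ρ_S ≥ 0`. [cite: Agmon1982, Ch.1; Balaban1985BackgroundPropagators, p.397, bookkeeping] -/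
theorem msRhoT_nonneg (hMh : 1 ≤ Mh) (hP : ∀ μ, 1 ≤ P μ) (S : ↥(bset D.toDomains)) (z : ↥(boxDom (N0 ℓ Mh k P))) :
    0 ≤ msRhoT D S z :=
  le_csInf (msRhoT_set_nonempty D hMh hP S z) (by rintro _ ⟨x, p, _, rfl⟩; exact wtLen_nonneg D p)

/-- `ρ_S(z)` is at most the weighted length of any walk from `z` into `S`. [cite: Balaban1985BackgroundPropagators, p.397, bookkeeping] -/
theorem msRhoT_le_wtLen {S : ↥(bset D.toDomains)} {z x : ↥(boxDom (N0 ℓ Mh k P))}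
    (p : (latGraphT (N0 ℓ Mh k P)).Walk z x) (hx : blkOf D.toDomains x = S) : msRhoT D S z ≤ wtLen D p :=
  csInf_le (msRhoT_set_bddBelow D S z) ⟨x, p, hx, rfl⟩

/-- **`ρ_S` VANISHES ON THE SOURCE BLOCK** (the shape of `dag-n06-w1`'s binder `hρB`). [cite: Agmon1982, Ch.1 (ρ = 0 on the support); Balaban1985BackgroundPropagators, (3.46) p.398] -/
theorem msRhoT_eq_zero_of_blkOf_eq (hMh : 1 ≤ Mh) (hP : ∀ μ, 1 ≤ P μ) {S : ↥(bset D.toDomains)}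
    {z : ↥(boxDom (N0 ℓ Mh k P))} (hz : blkOf D.toDomains z = S) : msRhoT D S z = 0 :=
  le_antisymm (by have h := msRhoT_le_wtLen D (SimpleGraph.Walk.nil : (latGraphT (N0 ℓ Mh k P)).Walk z z) hz; rwa [wtLen_nil] at h)
    (msRhoT_nonneg D hMh hP S z)

/-- **THE TRIANGLE INEQUALITY OF `ρ_S`**: `ρ_S(z) ≤ W(q) + ρ_S(w)` for every walk `q : z ⇝ w`. [cite: Agmon1982, Ch.1; Balaban1984PropagatorsII, (2.54) p.233, dictionary] -/
theorem msRhoT_le_add (hMh : 1 ≤ Mh) (hP : ∀ μ, 1 ≤ P μ) (S : ↥(bset D.toDomains)) {z w : ↥(boxDom (N0 ℓ Mh k P))}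
    (q : (latGraphT (N0 ℓ Mh k P)).Walk z w) : msRhoT D S z ≤ wtLen D q + msRhoT D S w := by
  rw [← sub_le_iff_le_add']
  refine le_csInf (msRhoT_set_nonempty D hMh hP S w) ?_
  rintro _ ⟨x, p, hx, rfl⟩
  have := msRhoT_le_wtLen D (q.append p) hx
  rw [wtLen_append] at this
  linarith

/-- ★ **`ρ_S` IS LIPSCHITZ ALONG LATTICE BONDS WITH THE STEP WEIGHT**: `|ρ_S z − ρ_S w| ≤ L^{−max(lev z, lev w)}` for adjacent
sites. [cite: Agmon1982, Ch.1 (admissible exponent); Balaban1985BackgroundPropagators, p.397 (steps in units of Lʲη)] -/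
theorem abs_msRhoT_sub_le_stepWt (hMh : 1 ≤ Mh) (hP : ∀ μ, 1 ≤ P μ) (S : ↥(bset D.toDomains))
    {z w : ↥(boxDom (N0 ℓ Mh k P))} (h : (latGraphT (N0 ℓ Mh k P)).Adj z w) :
    |msRhoT D S z - msRhoT D S w| ≤ stepWt D z w := by
  have h1 := msRhoT_le_add D hMh hP S (SimpleGraph.Walk.cons h SimpleGraph.Walk.nil)
  have h2 := msRhoT_le_add D hMh hP S (SimpleGraph.Walk.cons h.symm SimpleGraph.Walk.nil)
  rw [wtLen_cons, wtLen_nil, add_zero] at h1 h2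
  rw [stepWt_comm] at h2
  rw [abs_sub_le_iff]
  constructor <;> linarith

/-- ★ **THE FIRST BOND CAP** (the shape of `dag-n06-w1`'s `hρ1`): `|ρ_S(σ_{e_μ} z) − ρ_S z| ≤ (L^{lev z})⁻¹`.
[cite: Agmon1982, Ch.1; Balaban1985BackgroundPropagators, p.397 (weighted distance: steps in units of Lʲη)] -/
theorem abs_msRhoT_tshift_sub_le (hMh : 1 ≤ Mh) (hP : ∀ μ, 1 ≤ P μ) (S : ↥(bset D.toDomains)) (μ : Fin (d + 1))
    (z : ↥(boxDom (N0 ℓ Mh k P))) :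
    |msRhoT D S (tshift (N0 ℓ Mh k P) (unitVec μ) z) - msRhoT D S z| ≤ ((((ℓ + 1) ^ D.lev z.1 : ℕ) : ℝ))⁻¹ := by
  by_cases he : tshift (N0 ℓ Mh k P) (unitVec μ) z = z
  · rw [he, sub_self, abs_zero]; positivity
  · have hadj : (latGraphT (N0 ℓ Mh k P)).Adj z (tshift (N0 ℓ Mh k P) (unitVec μ) z) :=
      latGraphT_adj.2 ⟨Ne.symm he, Or.inl ⟨μ, rfl⟩⟩
    rw [abs_sub_comm]
    exact (abs_msRhoT_sub_le_stepWt D hMh hP S hadj).trans (stepWt_le_left D _ _)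

/-- ★ **THE SECOND BOND CAP** (the shape of `dag-n06-w1`'s `hρ2`): `|ρ_S(σ_{e_μ} z) − ρ_S z| ≤ (L^{lev(σ_{e_μ} z)})⁻¹`.
[cite: Agmon1982, Ch.1; Balaban1985BackgroundPropagators, p.397] -/
theorem abs_msRhoT_tshift_sub_le' (hMh : 1 ≤ Mh) (hP : ∀ μ, 1 ≤ P μ) (S : ↥(bset D.toDomains)) (μ : Fin (d + 1))
    (z : ↥(boxDom (N0 ℓ Mh k P))) :
    |msRhoT D S (tshift (N0 ℓ Mh k P) (unitVec μ) z) - msRhoT D S z|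
      ≤ ((((ℓ + 1) ^ D.lev (tshift (N0 ℓ Mh k P) (unitVec μ) z).1 : ℕ) : ℝ))⁻¹ := by
  by_cases he : tshift (N0 ℓ Mh k P) (unitVec μ) z = z
  · rw [he, sub_self, abs_zero]; positivity
  · have hadj : (latGraphT (N0 ℓ Mh k P)).Adj z (tshift (N0 ℓ Mh k P) (unitVec μ) z) :=
      latGraphT_adj.2 ⟨Ne.symm he, Or.inl ⟨μ, rfl⟩⟩
    rw [abs_sub_comm]
    exact (abs_msRhoT_sub_le_stepWt D hMh hP S hadj).trans (stepWt_le_right D _ _)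

/-- **THE IN-BLOCK STAIRCASE**: two sites of one block of level `j` are joined by a lattice walk inside the block whose weighted
length is at most `(Σ_μ |z_μ − w_μ|)·L^{−j}`. [cite: Balaban1984PropagatorsII, (2.1) p.224 (blocks are cubes of side Lʲ), dictionary] -/
theorem exists_walk_of_blkOf_eq_aux (s : ↥(bset D.toDomains)) :
    ∀ (n : ℕ) (z w : ↥(boxDom (N0 ℓ Mh k P))), blkOf D.toDomains z = s → blkOf D.toDomains w = s →
      (∑ μ, (z.1 μ - w.1 μ).natAbs) = n →
        ∃ q : (latGraphT (N0 ℓ Mh k P)).Walk z w, wtLen D q ≤ (n : ℝ) * ((((ℓ + 1) ^ s.1.1 : ℕ) : ℝ))⁻¹ := by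
  intro n
  induction n with
  | zero =>
      intro z w hz hw hsum
      have hzw : z = w := by
        apply Subtype.ext; funext μ
        have := (Finset.sum_eq_zero_iff.1 hsum) μ (Finset.mem_univ μ)
        omega
      subst hzw
      exact ⟨SimpleGraph.Walk.nil, by simp⟩
  | succ n ih =>
      intro z w hz hw hsum
      -- a coordinate where `z` and `w` differ
      have hex : ∃ μ, z.1 μ ≠ w.1 μ := by
        by_contra hcon
        push Not at hcon
        have : (∑ μ, (z.1 μ - w.1 μ).natAbs) = 0 := Finset.sum_eq_zero fun μ _ => by rw [hcon μ, sub_self]; rfl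
        omega
      obtain ⟨μ, hμ⟩ := hex
      have hzb := coord_bounds D.toDomains hz
      have hwb := coord_bounds D.toDomains hw
      have hzbox := mem_boxDom.1 z.2
      have hwbox := mem_boxDom.1 w.2
      -- the next site `z'`: one step towards `w` in direction `μ`
      obtain ⟨ε, hε, hεμ⟩ : ∃ ε : ℤ, (ε = 1 ∨ ε = -1) ∧ (z.1 μ - w.1 μ).natAbs = (z.1 μ + ε - w.1 μ).natAbs + 1 ∧
          (((ℓ + 1) ^ s.1.1 : ℕ) : ℤ) * s.1.2 μ ≤ z.1 μ + ε ∧ z.1 μ + ε < (((ℓ + 1) ^ s.1.1 : ℕ) : ℤ) * s.1.2 μ + (((ℓ + 1) ^ s.1.1 : ℕ) : ℤ)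
          ∧ 0 ≤ z.1 μ + ε ∧ z.1 μ + ε < N0 ℓ Mh k P μ := by
        rcases lt_or_gt_of_ne hμ with hlt | hgt
        · refine ⟨1, Or.inl rfl, by omega, by linarith [(hzb μ).1], by linarith [(hwb μ).2], by linarith [(hzbox μ).1],
            by linarith [(hwbox μ).2]⟩
        · refine ⟨-1, Or.inr rfl, by omega, by linarith [(hwb μ).1], by linarith [(hzb μ).2], by linarith [(hwbox μ).1],
            by linarith [(hzbox μ).2]⟩
      obtain ⟨hnat, hc1, hc2, hb1, hb2⟩ := hεμ
      set z'v : Fin (d + 1) → ℤ := z.1 + Pi.single μ ε with hz'v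
      have hz'μ : z'v μ = z.1 μ + ε := by rw [hz'v, Pi.add_apply, Pi.single_eq_same]
      have hz'ν : ∀ ν, ν ≠ μ → z'v ν = z.1 ν := fun ν hν => by rw [hz'v, Pi.add_apply, Pi.single_eq_of_ne hν, add_zero]
      have hz'mem : z'v ∈ boxDom (N0 ℓ Mh k P) := mem_boxDom.2 fun ν => by
        by_cases hν : ν = μ
        · subst hν; rw [hz'μ]; exact ⟨hb1, hb2⟩
        · rw [hz'ν ν hν]; exact hzbox ν
      set z' : ↥(boxDom (N0 ℓ Mh k P)) := ⟨z'v, hz'mem⟩ with hz'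
      have hz's : blkOf D.toDomains z' = s := blkOf_eq_of_coords D fun ν => by
        by_cases hν : ν = μ
        · subst hν; show _ ≤ z'v ν ∧ z'v ν < _; rw [hz'μ]; exact ⟨hc1, hc2⟩
        · show _ ≤ z'v ν ∧ z'v ν < _; rw [hz'ν ν hν]; exact hzb ν
      -- `z` and `z'` are adjacent
      have hne : z ≠ z' := by
        intro h
        have : z.1 μ = z'v μ := by rw [h]
        rw [hz'μ] at this
        rcases hε with rfl | rfl <;> omega
      have hadj : (latGraphT (N0 ℓ Mh k P)).Adj z z' := by
        rcases hε with rfl | rfl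
        · refine latGraphT_adj.2 ⟨hne, Or.inl ⟨μ, ?_⟩⟩
          apply Subtype.ext
          rw [tshift_val_of_mem (by rw [unitVec]; exact hz'mem)]
          rfl
        · refine latGraphT_adj.2 ⟨hne, Or.inr ⟨μ, ?_⟩⟩
          apply Subtype.ext
          have hmem : z'.1 + unitVec μ ∈ boxDom (N0 ℓ Mh k P) := by
            have e : z'.1 + unitVec μ = z.1 := by
              funext ν; rw [hz']; change z'v ν + unitVec μ ν = z.1 ν
              by_cases hν : ν = μ
              · subst hν; rw [hz'μ, unitVec, Pi.single_eq_same]; ring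
              · rw [hz'ν ν hν, unitVec, Pi.single_eq_of_ne hν, add_zero]
            rw [e]; exact z.2
          rw [tshift_val_of_mem hmem]
          funext ν; change z.1 ν = z'v ν + unitVec μ ν
          by_cases hν : ν = μ
          · subst hν; rw [hz'μ, unitVec, Pi.single_eq_same]; ring
          · rw [hz'ν ν hν, unitVec, Pi.single_eq_of_ne hν, add_zero]
      -- the remaining sum is `n`
      have hsum' : (∑ ν, (z'.1 ν - w.1 ν).natAbs) = n := by
        have e : ∀ ν, (z.1 ν - w.1 ν).natAbs = (z'.1 ν - w.1 ν).natAbs + (if ν = μ then 1 else 0) := by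
          intro ν
          by_cases hν : ν = μ
          · subst hν; rw [if_pos rfl]; change _ = (z'v ν - w.1 ν).natAbs + 1; rw [hz'μ]; exact hnat
          · rw [if_neg hν, add_zero]; change _ = (z'v ν - w.1 ν).natAbs; rw [hz'ν ν hν]
        have := hsum
        simp only [e, Finset.sum_add_distrib, Finset.sum_ite_eq', Finset.mem_univ, if_true] at this
        omega
      obtain ⟨q', hq'⟩ := ih z' w hz's hw hsum'
      refine ⟨SimpleGraph.Walk.cons hadj q', ?_⟩
      rw [wtLen_cons]
      have hwt : stepWt D z z' = ((((ℓ + 1) ^ s.1.1 : ℕ) : ℝ))⁻¹ := by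
        unfold stepWt
        rw [show D.lev z.1 = s.1.1 from lev_eq_of_blkOf_eq D.toDomains hz,
          show D.lev z'.1 = s.1.1 from lev_eq_of_blkOf_eq D.toDomains hz's, max_self]
      rw [hwt, Nat.cast_succ, add_mul, one_mul]
      linarith

/-- the in-block staircase has weighted length `≤ d + 1` (each coordinate differs by `≤ Lʲ − 1` inside a block of side `Lʲ`).
[cite: Balaban1984PropagatorsII, (2.1) p.224, dictionary] -/
theorem exists_walk_of_blkOf_eq {z w : ↥(boxDom (N0 ℓ Mh k P))} (h : blkOf D.toDomains w = blkOf D.toDomains z) :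
    ∃ q : (latGraphT (N0 ℓ Mh k P)).Walk z w, wtLen D q ≤ (d : ℝ) + 1 := by
  obtain ⟨q, hq⟩ := exists_walk_of_blkOf_eq_aux D (blkOf D.toDomains z) _ z w rfl h rfl
  refine ⟨q, hq.trans ?_⟩
  -- `Σ_μ |z_μ − w_μ| ≤ (d+1)(Lʲ − 1)` and `(Lʲ − 1)·L^{−j} ≤ 1`
  have hzb := coord_bounds D.toDomains (rfl : blkOf D.toDomains z = blkOf D.toDomains z)
  have hwb := coord_bounds D.toDomains h
  have hcoord : ∀ μ, ((z.1 μ - w.1 μ).natAbs : ℝ) ≤ (((ℓ + 1) ^ (blkOf D.toDomains z).1.1 : ℕ) : ℝ) - 1 := by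
    intro μ
    have h1 := hzb μ
    have h2 := hwb μ
    have h3 : (z.1 μ - w.1 μ).natAbs + 1 ≤ (ℓ + 1) ^ (blkOf D.toDomains z).1.1 := by omega
    have h4 : (((z.1 μ - w.1 μ).natAbs + 1 : ℕ) : ℝ) ≤ (((ℓ + 1) ^ (blkOf D.toDomains z).1.1 : ℕ) : ℝ) :=
      (Nat.cast_le (α := ℝ)).2 h3
    rw [Nat.cast_add, Nat.cast_one] at h4
    linarith
  have hsum : ((∑ μ, (z.1 μ - w.1 μ).natAbs : ℕ) : ℝ)
      ≤ ((d : ℝ) + 1) * ((((ℓ + 1) ^ (blkOf D.toDomains z).1.1 : ℕ) : ℝ) - 1) := by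
    rw [Nat.cast_sum]
    calc (∑ μ, ((z.1 μ - w.1 μ).natAbs : ℝ)) ≤ ∑ _μ : Fin (d + 1), ((((ℓ + 1) ^ (blkOf D.toDomains z).1.1 : ℕ) : ℝ) - 1) :=
          Finset.sum_le_sum fun μ _ => hcoord μ
      _ = ((d : ℝ) + 1) * ((((ℓ + 1) ^ (blkOf D.toDomains z).1.1 : ℕ) : ℝ) - 1) := by
          rw [Finset.sum_const, Finset.card_univ, Fintype.card_fin, nsmul_eq_mul]; push_cast; ring
  have hpos : (0 : ℝ) < (((ℓ + 1) ^ (blkOf D.toDomains z).1.1 : ℕ) : ℝ) := by positivity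
  have hd0 : (0 : ℝ) ≤ (d : ℝ) + 1 := by positivity
  have hfrac : ((((ℓ + 1) ^ (blkOf D.toDomains z).1.1 : ℕ) : ℝ) - 1) * ((((ℓ + 1) ^ (blkOf D.toDomains z).1.1 : ℕ) : ℝ))⁻¹ ≤ 1 := by
    rw [sub_mul, mul_inv_cancel₀ hpos.ne']
    linarith [inv_nonneg.2 hpos.le]
  calc ((∑ μ, (z.1 μ - w.1 μ).natAbs : ℕ) : ℝ) * ((((ℓ + 1) ^ (blkOf D.toDomains z).1.1 : ℕ) : ℝ))⁻¹
      ≤ ((d : ℝ) + 1) * ((((ℓ + 1) ^ (blkOf D.toDomains z).1.1 : ℕ) : ℝ) - 1) * ((((ℓ + 1) ^ (blkOf D.toDomains z).1.1 : ℕ) : ℝ))⁻¹ :=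
        mul_le_mul_of_nonneg_right hsum (by positivity)
    _ = ((d : ℝ) + 1) * (((((ℓ + 1) ^ (blkOf D.toDomains z).1.1 : ℕ) : ℝ) - 1) * ((((ℓ + 1) ^ (blkOf D.toDomains z).1.1 : ℕ) : ℝ))⁻¹) := by
        ring
    _ ≤ (d : ℝ) + 1 := by
        have := mul_le_of_le_one_right hd0 hfrac
        simpa using this

/-- ★ **THE BLOCK OSCILLATION** (the shape of `dag-n06-w1`'s `hρD` with `D = d + 1`): `|ρ_S z − ρ_S w| ≤ d + 1` for two sites of
one block. [cite: Agmon1982, Ch.1; Balaban1984PropagatorsII, (2.3)–(2.4) p.224 (weights constant on blocks); Balaban1985BackgroundPropagators, p.397] -/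
theorem abs_msRhoT_sub_le_of_blkOf_eq (hMh : 1 ≤ Mh) (hP : ∀ μ, 1 ≤ P μ) (S : ↥(bset D.toDomains))
    {z w : ↥(boxDom (N0 ℓ Mh k P))} (h : blkOf D.toDomains w = blkOf D.toDomains z) :
    |msRhoT D S z - msRhoT D S w| ≤ (d : ℝ) + 1 := by
  obtain ⟨q, hq⟩ := exists_walk_of_blkOf_eq D h
  obtain ⟨q', hq'⟩ := exists_walk_of_blkOf_eq D h.symm
  have h1 := msRhoT_le_add D hMh hP S q
  have h2 := msRhoT_le_add D hMh hP S q'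
  rw [abs_sub_le_iff]
  constructor <;> linarith

/-- ★★★ **DOMINATION: PRINT'S BLOCK DISTANCE (2.46) IS AN ADMISSIBLE AGMON RATE** —
`(d_T(y(z), S) − 1)∕(2L) ≤ ρ_S(z)` for every site `z` and every block `S` of `𝔅`; with `dag-n06-w1`'s
`hs_restrict_GpY_parSymY_le_exp_canonical` this turns the Agmon bound into decay `e^{−δ₀ (d_T − 1)∕(2L)}` in the block distance,
uniformly in `k`, the volume and the member. [cite: Balaban1984PropagatorsII, (2.46) p.231, (2.1)–(2.2) p.224; Balaban1985BackgroundPropagators, Thm 3.1 (3.46) p.398, p.397; Agmon1982, Ch.1] -/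
theorem msRhoT_ge (hR : 1 ≤ R) (hMh : 1 ≤ Mh) (hP : ∀ μ, 1 ≤ P μ) (hℓ : 1 ≤ ℓ) (S : ↥(bset D.toDomains))
    (z : ↥(boxDom (N0 ℓ Mh k P))) :
    (((bondT D).dist (blkOf D.toDomains z) S : ℝ) - 1) / (2 * ((ℓ + 1 : ℕ) : ℝ)) ≤ msRhoT D S z := by
  have hLpos : (0 : ℝ) < 2 * ((ℓ + 1 : ℕ) : ℝ) := by positivity
  refine le_csInf (msRhoT_set_nonempty D hMh hP S z) ?_
  rintro _ ⟨x, p, hx, rfl⟩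
  have h := distT_blkOf_le_of_walk D hR hMh hP hℓ p
  rw [hx] at h
  rw [div_le_iff₀ hLpos]
  linarith

/-- the same in print's geometry `geomT D` (`(geomT D).dist = d_T` cast to `ℝ`): `((geomT D).dist (y z) S − 1)∕(2L) ≤ ρ_S z`.
[cite: Balaban1984PropagatorsII, (2.46) p.231; Balaban1985BackgroundPropagators, p.397] -/
theorem msRhoT_ge_geomT (hR : 1 ≤ R) (hMh : 1 ≤ Mh) (hP : ∀ μ, 1 ≤ P μ) (hℓ : 1 ≤ ℓ) (S : ↥(bset D.toDomains))
    (z : ↥(boxDom (N0 ℓ Mh k P))) :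
    ((geomT D).dist (blkOf D.toDomains z) S - 1) / (2 * ((ℓ + 1 : ℕ) : ℝ)) ≤ msRhoT D S z :=
  msRhoT_ge D hR hMh hP hℓ S z

end Exponent

end

end Literature.MathematicalPhysics.QuantumFieldTheory.Balaban1983to89.B6AgmonExponentMultiLevelTorus
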